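import Mathlib
import Literature.Analysis.FluidPDE.VectorCalculus
import Literature.Analysis.FluidPDE.LeiZhang2011Proofs
import Summits.NavierStokesRegularity.NavierStokesRegularity.Theorems.FilamentSkeletonRssSkeletonEquilibriumBiotSavartDifferentiable
import Summits.NavierStokesRegularity.NavierStokesRegularity.Theorems.FilamentSkeletonRssSkeletonEquilibriumBiotSavartDirectionalDeriv

/-!
# Route `FilamentSkeletonRss` · crux `SelectionBoxRJ` (stmt-NavierStokesRegularity-21220) — rung tools:
# the `1/D²` bound for the GRADIENT of the regularised Biot–Savart field of a filament at distance `D`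

Lane `ns-filament-19175-p1` (g6); the strain half of nonlocal brick (N2) of the memo `SIGMA-SCALING-21220.md` (item
evidence #18, §4–§5).  Helper file `--supports stmt-NavierStokesRegularity-21220`; route-independent.

By the full-slip law (`…RungSlipLaw`: `w′ = ½ + ⟪U′, X′⟫`, `box_slip_zero_unique`) extra stagnation zeros of a
filament need axial strain `≤ −½` of the non-local velocity along it; the partner filaments contribute through the
gradient of their regularised Biot–Savart field `F(y) = ∫ K₃(y − X u) • X′(u) × (y − X u) du`.  The tree has the
explicit directional derivative of `F` with integrable derivative integrand (`stub_biotSavartDirectionalDeriv`) and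
the differentiability of `F` (`stub_biotSavartDifferentiable`).  This file adds the quantitative decay:

* `biotSavart_gradIntegrand_norm_le` — the derivative integrand has norm `≤ 4‖v‖/r³`, `r = ‖y − X u‖ > 0`
  (`3r² K₅ + K₃ ≤ 4 r⁻³`, uniformly in the core `e`).
* `biotSavart_gradIntegral_bound` — if the point `y` sees the filament at distance `≥ D > 0` everywhere and with
  linear escape `c|u − u₀| − A ≤ ‖y − X u‖` (`c > 0`, `A ≥ 0`, any centre `u₀`), then the derivative integral has
  norm `≤ 8π‖v‖(D + A)/(c D³)` (Cauchy majorant `(8‖v‖/D³)(1 + (c(u − u₀)/(D + A))²)⁻¹`).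
* `biotSavart_fderiv_apply_eq`, `biotSavart_fderiv_norm_le` — hence, for a `C¹` filament with `‖X′‖ ≤ 1` and linear
  growth (the stubs' hypotheses), `fderiv F y v` IS that integral and `‖fderiv F y‖ ≤ 8π(D + A)/(c D³)`.
* `biotSavart_axialStrain_le` — in particular the axial strain `|⟪a, (fderiv F y) a⟫| ≤ 8π(D + A)/(c D³)` for every
  unit `a`: with the box's prefactor `Γγ_k/4π`, `D = d√Γ`, `A ≍ D`, `c ≍ 1` this is the `Γ`-free `O(γ_k/d²)` partner
  strain of the memo (§4: zeros of `w_j` confined to `d ≲ √γ_k`), now a kernel inequality.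

HONEST FRAMING.  Kernel estimates for the rung ladder of a HYPOTHETICAL filament box; nothing here is a claim about
Navier–Stokes regularity or blow-up.
-/

set_option linter.dupNamespace false

noncomputable section

namespace Summit.NavierStokesRegularity.NavierStokesRegularity.Theorems

open Set Function Filter MeasureTheory Real
open Literature.Analysis.FluidPDE
open Summit.NavierStokesRegularity.NavierStokesRegularity.Theorems.SkeletonEquilibrium.Sketch
open scoped InnerProductSpace Topology

namespace SelectionBoxRJRung

/-- `(r²)^{p/2}`-type identities: `(r²)^{3/2} = r³` and `(r²)^{5/2} = r⁵` for `0 ≤ r`, packaged as the two kernel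
bounds `((r² + e²)^{3/2})⁻¹ ≤ (r³)⁻¹`, `((r² + e²)^{5/2})⁻¹ ≤ (r⁵)⁻¹` for `0 < r`. [folklore] -/
theorem rosenhead_kernel_le_inv_pow {r : ℝ} (hr : 0 < r) (e : ℝ) :
    ((r ^ 2 + e ^ 2) ^ (3 / 2 : ℝ))⁻¹ ≤ (r ^ 3)⁻¹ ∧ ((r ^ 2 + e ^ 2) ^ (5 / 2 : ℝ))⁻¹ ≤ (r ^ 5)⁻¹ := by
  have hre : r ^ 2 ≤ r ^ 2 + e ^ 2 := le_add_of_nonneg_right (sq_nonneg e)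
  have h3 : (r ^ 2) ^ (3 / 2 : ℝ) = r ^ 3 := by
    rw [← Real.rpow_natCast r 2, ← Real.rpow_mul hr.le]; norm_num
  have h5 : (r ^ 2) ^ (5 / 2 : ℝ) = r ^ 5 := by
    rw [← Real.rpow_natCast r 2, ← Real.rpow_mul hr.le]; norm_num
  constructor
  · have := Real.rpow_le_rpow (sq_nonneg r) hre (by norm_num : (0:ℝ) ≤ 3 / 2)
    rw [h3] at this
    exact inv_anti₀ (pow_pos hr 3) this
  · have := Real.rpow_le_rpow (sq_nonneg r) hre (by norm_num : (0:ℝ) ≤ 5 / 2)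
    rw [h5] at this
    exact inv_anti₀ (pow_pos hr 5) this

/-- **Pointwise bound for the derivative integrand** of `stub_biotSavartDirectionalDeriv`: with `w = y − X u`,
`r = ‖w‖ > 0`, `‖X′ u‖ ≤ 1`, the vector `−3⟪w, v⟫K₅ • X′u × w + K₃ • X′u × v` has norm `≤ 4‖v‖/r³`. [folklore] -/
theorem biotSavart_gradIntegrand_norm_le (e : ℝ) {T w v : EuclideanSpace ℝ (Fin 3)} (hT : ‖T‖ ≤ 1)
    (hw : 0 < ‖w‖) :
    ‖(-3 * ⟪w, v⟫_ℝ * ((‖w‖ ^ 2 + e ^ 2) ^ (5 / 2 : ℝ))⁻¹) • cross T w +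
        ((‖w‖ ^ 2 + e ^ 2) ^ (3 / 2 : ℝ))⁻¹ • cross T v‖ ≤ 4 * ‖v‖ / ‖w‖ ^ 3 := by
  set r := ‖w‖ with hr
  obtain ⟨hK3, hK5⟩ := rosenhead_kernel_le_inv_pow hw e
  have hK5nn : 0 ≤ ((r ^ 2 + e ^ 2) ^ (5 / 2 : ℝ))⁻¹ := inv_nonneg.2 (Real.rpow_nonneg (by positivity) _)
  have hK3nn : 0 ≤ ((r ^ 2 + e ^ 2) ^ (3 / 2 : ℝ))⁻¹ := inv_nonneg.2 (Real.rpow_nonneg (by positivity) _)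
  have hcw : ‖cross T w‖ ≤ r := by
    calc ‖cross T w‖ ≤ ‖T‖ * ‖w‖ := norm_cross_le_norm_mul_norm T w
      _ ≤ 1 * ‖w‖ := mul_le_mul_of_nonneg_right hT (norm_nonneg _)
      _ = r := by rw [one_mul]
  have hcv : ‖cross T v‖ ≤ ‖v‖ := by
    calc ‖cross T v‖ ≤ ‖T‖ * ‖v‖ := norm_cross_le_norm_mul_norm T v
      _ ≤ 1 * ‖v‖ := mul_le_mul_of_nonneg_right hT (norm_nonneg _)
      _ = ‖v‖ := one_mul _
  have hinner : |⟪w, v⟫_ℝ| ≤ r * ‖v‖ := abs_real_inner_le_norm w v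
  have h1 : ‖(-3 * ⟪w, v⟫_ℝ * ((r ^ 2 + e ^ 2) ^ (5 / 2 : ℝ))⁻¹) • cross T w‖ ≤ 3 * ‖v‖ / r ^ 3 := by
    rw [norm_smul, Real.norm_eq_abs, abs_mul, abs_mul, abs_of_nonneg hK5nn,
      show |(-3 : ℝ)| = 3 by norm_num]
    calc 3 * |⟪w, v⟫_ℝ| * ((r ^ 2 + e ^ 2) ^ (5 / 2 : ℝ))⁻¹ * ‖cross T w‖
        ≤ 3 * (r * ‖v‖) * (r ^ 5)⁻¹ * r := by
          gcongr
      _ = 3 * ‖v‖ / r ^ 3 := by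
          field_simp
  have h2 : ‖((r ^ 2 + e ^ 2) ^ (3 / 2 : ℝ))⁻¹ • cross T v‖ ≤ ‖v‖ / r ^ 3 := by
    rw [norm_smul, Real.norm_of_nonneg hK3nn]
    calc ((r ^ 2 + e ^ 2) ^ (3 / 2 : ℝ))⁻¹ * ‖cross T v‖ ≤ (r ^ 3)⁻¹ * ‖v‖ :=
          mul_le_mul hK3 hcv (norm_nonneg _) (inv_nonneg.2 (pow_nonneg hw.le 3))
      _ = ‖v‖ / r ^ 3 := by rw [inv_mul_eq_div]
  calc _ ≤ 3 * ‖v‖ / r ^ 3 + ‖v‖ / r ^ 3 := norm_add_le_of_le h1 h2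
    _ = 4 * ‖v‖ / r ^ 3 := by ring

/-- The elementary inequality behind the Cauchy majorant: if `0 < D ≤ r`, `0 ≤ A`, `0 < c` and
`c|u − u₀| − A ≤ r`, then `D² (1 + (c(u − u₀)/(D + A))²) ≤ 2 r²`. [folklore] -/
theorem cauchy_majorant_core {D A c u u₀ r : ℝ} (hD : 0 < D) (hA : 0 ≤ A) (hc : 0 < c)
    (hDr : D ≤ r) (hur : c * |u - u₀| - A ≤ r) :
    D ^ 2 * (1 + (c * (u - u₀) / (D + A)) ^ 2) ≤ 2 * r ^ 2 := by
  -- adapted from the private `bsff_abs_scaled_le` / `bsff_inv_sq_le_majorant` of …BiotSavartFarField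
  have hDA : 0 < D + A := by linarith
  have key : D * (c * |u - u₀|) ≤ r * (D + A) := by
    rcases le_or_gt (c * |u - u₀|) (D + A) with h | h
    · nlinarith [mul_nonneg (sub_nonneg.2 hDr) hDA.le, mul_nonneg hD.le (sub_nonneg.2 h)]
    · nlinarith [mul_nonneg (sub_nonneg.2 hur) hDA.le, mul_nonneg hA (sub_nonneg.2 h.le)]
  have h1 : (D * (c * (u - u₀) / (D + A))) ^ 2 ≤ r ^ 2 := by
    have habs : |D * (c * (u - u₀) / (D + A))| ≤ r := by
      rw [abs_mul, abs_of_pos hD, abs_div, abs_of_pos hDA, abs_mul, abs_of_pos hc, mul_div_assoc',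
        div_le_iff₀ hDA]
      exact key
    have h := pow_le_pow_left₀ (abs_nonneg _) habs 2
    rwa [sq_abs] at h
  have h2 : D ^ 2 ≤ r ^ 2 := pow_le_pow_left₀ hD.le hDr 2
  nlinarith [h1, h2]

/-- **Decay of the gradient integral.** If `‖X′‖ ≤ 1`, the point `y` is at distance `≥ D > 0` from the whole
filament and sees it with linear escape `c|u − u₀| − A ≤ ‖y − X u‖` (`c > 0`, `A ≥ 0`), then the derivative integral
of `stub_biotSavartDirectionalDeriv` in the direction `v` has norm `≤ 8π‖v‖(D + A)/(c D³)` (any core `e`; no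
integrability needed). [folklore] -/
theorem biotSavart_gradIntegral_bound (e : ℝ) {c D A u₀ : ℝ} {X : ℝ → EuclideanSpace ℝ (Fin 3)}
    {y v : EuclideanSpace ℝ (Fin 3)} (hc : 0 < c) (hD : 0 < D) (hA : 0 ≤ A) (hdX : ∀ u, ‖deriv X u‖ ≤ 1)
    (hfar : ∀ u, D ≤ ‖y - X u‖) (hesc : ∀ u, c * |u - u₀| - A ≤ ‖y - X u‖) :
    ‖∫ u : ℝ, ((-3 * ⟪y - X u, v⟫_ℝ * ((‖y - X u‖ ^ 2 + e ^ 2) ^ (5 / 2 : ℝ))⁻¹) • cross (deriv X u) (y - X u)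
        + ((‖y - X u‖ ^ 2 + e ^ 2) ^ (3 / 2 : ℝ))⁻¹ • cross (deriv X u) v)‖ ≤
      8 * Real.pi * ‖v‖ * (D + A) / (c * D ^ 3) := by
  have hDA : 0 < D + A := by linarith
  set k : ℝ := c / (D + A) with hk
  have hkpos : 0 < k := div_pos hc hDA
  -- the Cauchy majorant and its integral
  set g : ℝ → ℝ := fun u => 8 * ‖v‖ / D ^ 3 * (1 + (k * (u - u₀)) ^ 2)⁻¹ with hg
  have hg_int : Integrable g := by
    have h0 : Integrable (fun u : ℝ => (1 + (k * u) ^ 2)⁻¹) :=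
      integrable_inv_one_add_sq.comp_mul_left' hkpos.ne'
    have h1 : Integrable (fun u : ℝ => (1 + (k * (u - u₀)) ^ 2)⁻¹) := h0.comp_sub_right u₀
    exact h1.const_mul _
  have hg_val : ∫ u, g u = 8 * ‖v‖ / D ^ 3 * ((D + A) / c * Real.pi) := by
    rw [hg, integral_const_mul]
    congr 1
    have h1 : ∫ u : ℝ, (1 + (k * (u - u₀)) ^ 2)⁻¹ = ∫ u : ℝ, (1 + (k * u) ^ 2)⁻¹ :=
      integral_sub_right_eq_self (fun u : ℝ => (1 + (k * u) ^ 2)⁻¹) u₀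
    rw [h1, Measure.integral_comp_mul_left (fun y : ℝ => (1 + y ^ 2)⁻¹), integral_univ_inv_one_add_sq,
      smul_eq_mul, hk, inv_div, abs_of_pos (div_pos hDA hc)]
  -- pointwise domination
  have hbound : ∀ u : ℝ,
      ‖(-3 * ⟪y - X u, v⟫_ℝ * ((‖y - X u‖ ^ 2 + e ^ 2) ^ (5 / 2 : ℝ))⁻¹) • cross (deriv X u) (y - X u)
        + ((‖y - X u‖ ^ 2 + e ^ 2) ^ (3 / 2 : ℝ))⁻¹ • cross (deriv X u) v‖ ≤ g u := by
    intro u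
    have hr : D ≤ ‖y - X u‖ := hfar u
    have hrpos : 0 < ‖y - X u‖ := lt_of_lt_of_le hD hr
    have h1 := biotSavart_gradIntegrand_norm_le e (v := v) (hdX u) hrpos
    have hcore := cauchy_majorant_core hD hA hc hr (hesc u)
    -- `4‖v‖/r³ ≤ (8‖v‖/D³)(1 + (k(u-u₀))²)⁻¹`
    have hkq : k * (u - u₀) = c * (u - u₀) / (D + A) := by rw [hk]; ring
    have hcore' : D ^ 2 * (1 + (k * (u - u₀)) ^ 2) ≤ 2 * ‖y - X u‖ ^ 2 := by rw [hkq]; exact hcore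
    have hq : 0 < 1 + (k * (u - u₀)) ^ 2 := by positivity
    have hK : D ^ 2 / (2 * ‖y - X u‖ ^ 2) ≤ (1 + (k * (u - u₀)) ^ 2)⁻¹ := by
      rw [inv_eq_one_div, div_le_div_iff₀ (by positivity) hq]
      nlinarith [hcore']
    have hmaj : 4 * ‖v‖ / ‖y - X u‖ ^ 3 ≤ g u := by
      show 4 * ‖v‖ / ‖y - X u‖ ^ 3 ≤ 8 * ‖v‖ / D ^ 3 * (1 + (k * (u - u₀)) ^ 2)⁻¹
      calc 4 * ‖v‖ / ‖y - X u‖ ^ 3 ≤ 4 * ‖v‖ / (D * ‖y - X u‖ ^ 2) := by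
            refine div_le_div_of_nonneg_left (by positivity) (by positivity) ?_
            nlinarith [pow_pos hrpos 2, hr]
        _ = 8 * ‖v‖ / D ^ 3 * (D ^ 2 / (2 * ‖y - X u‖ ^ 2)) := by
            field_simp
            ring
        _ ≤ 8 * ‖v‖ / D ^ 3 * (1 + (k * (u - u₀)) ^ 2)⁻¹ := mul_le_mul_of_nonneg_left hK (by positivity)
    exact h1.trans hmaj
  have hfin : 8 * ‖v‖ / D ^ 3 * ((D + A) / c * Real.pi) = 8 * Real.pi * ‖v‖ * (D + A) / (c * D ^ 3) := by
    field_simp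
  calc _ ≤ ∫ u, g u := norm_integral_le_of_norm_le hg_int (Eventually.of_forall hbound)
    _ = 8 * ‖v‖ / D ^ 3 * ((D + A) / c * Real.pi) := hg_val
    _ = 8 * Real.pi * ‖v‖ * (D + A) / (c * D ^ 3) := hfin

/-- **The Fréchet derivative of the regularised Biot–Savart field is the directional-derivative integral.**  Under
the hypotheses of `stub_biotSavartDifferentiable` / `stub_biotSavartDirectionalDeriv` (`e ≠ 0`, `C¹` filament,
`‖X′‖ ≤ 1`, linear growth `c₀|u| − C ≤ ‖X u‖`), for every `y, v`:
`fderiv F y v = ∫ (−3⟪y − X u, v⟫K₅ • X′u × (y − X u) + K₃ • X′u × v) du`. [folklore] -/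
theorem biotSavart_fderiv_apply_eq {e c₀ C : ℝ} {X : ℝ → EuclideanSpace ℝ (Fin 3)} (he : e ≠ 0) (hc₀ : 0 < c₀)
    (hX : ContDiff ℝ 1 X) (hdX : ∀ u, ‖deriv X u‖ ≤ 1) (hgrow : ∀ u, c₀ * |u| - C ≤ ‖X u‖)
    (y v : EuclideanSpace ℝ (Fin 3)) :
    fderiv ℝ (fun y : EuclideanSpace ℝ (Fin 3) => ∫ u : ℝ,
        ((‖y - X u‖ ^ 2 + e ^ 2) ^ (3 / 2 : ℝ))⁻¹ • cross (deriv X u) (y - X u)) y v =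
      ∫ u : ℝ, ((-3 * ⟪y - X u, v⟫_ℝ * ((‖y - X u‖ ^ 2 + e ^ 2) ^ (5 / 2 : ℝ))⁻¹) • cross (deriv X u) (y - X u)
        + ((‖y - X u‖ ^ 2 + e ^ 2) ^ (3 / 2 : ℝ))⁻¹ • cross (deriv X u) v) := by
  set F : EuclideanSpace ℝ (Fin 3) → EuclideanSpace ℝ (Fin 3) := fun y => ∫ u : ℝ,
    ((‖y - X u‖ ^ 2 + e ^ 2) ^ (3 / 2 : ℝ))⁻¹ • cross (deriv X u) (y - X u) with hF
  have hdiff : Differentiable ℝ F := stub_biotSavartDifferentiable e c₀ C X he hc₀ hX hdX hgrow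
  obtain ⟨-, hdir⟩ := stub_biotSavartDirectionalDeriv e c₀ C X he hc₀ hX hdX hgrow y v
  -- the same path derivative through the chain rule
  have hpath : HasDerivAt (fun s : ℝ => y + s • v) v 0 := by
    have h := ((hasDerivAt_id (0 : ℝ)).smul_const v).const_add y
    simpa using h
  have hchain : HasDerivAt (fun s : ℝ => F (y + s • v)) (fderiv ℝ F y v) 0 := by
    have h := (hdiff y).hasFDerivAt.comp_hasDerivAt_of_eq (0 : ℝ) hpath (by simp)
    exact h
  have hdir' : HasDerivAt (fun s : ℝ => F (y + s • v))
      (∫ u : ℝ, ((-3 * ⟪y - X u, v⟫_ℝ * ((‖y - X u‖ ^ 2 + e ^ 2) ^ (5 / 2 : ℝ))⁻¹) •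
          cross (deriv X u) (y - X u) + ((‖y - X u‖ ^ 2 + e ^ 2) ^ (3 / 2 : ℝ))⁻¹ • cross (deriv X u) v)) 0 := by
    simpa [hF] using hdir
  exact hchain.unique hdir'

/-- **`1/D²` decay of the field gradient.**  Under the stubs' hypotheses and the local geometry of
`biotSavart_gradIntegral_bound` (`y` at distance `≥ D` from the filament, linear escape `c|u − u₀| − A ≤ ‖y − X u‖`):
`‖fderiv F y‖ ≤ 8π(D + A)/(c D³)`. [folklore] -/
theorem biotSavart_fderiv_norm_le {e c₀ C c D A u₀ : ℝ} {X : ℝ → EuclideanSpace ℝ (Fin 3)} (he : e ≠ 0)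
    (hc₀ : 0 < c₀) (hX : ContDiff ℝ 1 X) (hdX : ∀ u, ‖deriv X u‖ ≤ 1) (hgrow : ∀ u, c₀ * |u| - C ≤ ‖X u‖)
    {y : EuclideanSpace ℝ (Fin 3)} (hc : 0 < c) (hD : 0 < D) (hA : 0 ≤ A)
    (hfar : ∀ u, D ≤ ‖y - X u‖) (hesc : ∀ u, c * |u - u₀| - A ≤ ‖y - X u‖) :
    ‖fderiv ℝ (fun y : EuclideanSpace ℝ (Fin 3) => ∫ u : ℝ,
        ((‖y - X u‖ ^ 2 + e ^ 2) ^ (3 / 2 : ℝ))⁻¹ • cross (deriv X u) (y - X u)) y‖ ≤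
      8 * Real.pi * (D + A) / (c * D ^ 3) := by
  refine ContinuousLinearMap.opNorm_le_bound _ (by positivity) fun v => ?_
  rw [biotSavart_fderiv_apply_eq he hc₀ hX hdX hgrow y v]
  calc _ ≤ 8 * Real.pi * ‖v‖ * (D + A) / (c * D ^ 3) := biotSavart_gradIntegral_bound e hc hD hA hdX hfar hesc
    _ = 8 * Real.pi * (D + A) / (c * D ^ 3) * ‖v‖ := by ring

/-- **Partner axial strain bound.**  Under the same hypotheses, for every unit vector `a` (the tangent of another
filament at the point `y`), `|⟪a, (fderiv F y) a⟫| ≤ 8π(D + A)/(c D³)`. [folklore] -/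
theorem biotSavart_axialStrain_le {e c₀ C c D A u₀ : ℝ} {X : ℝ → EuclideanSpace ℝ (Fin 3)} (he : e ≠ 0)
    (hc₀ : 0 < c₀) (hX : ContDiff ℝ 1 X) (hdX : ∀ u, ‖deriv X u‖ ≤ 1) (hgrow : ∀ u, c₀ * |u| - C ≤ ‖X u‖)
    {y a : EuclideanSpace ℝ (Fin 3)} (ha : ‖a‖ = 1) (hc : 0 < c) (hD : 0 < D) (hA : 0 ≤ A)
    (hfar : ∀ u, D ≤ ‖y - X u‖) (hesc : ∀ u, c * |u - u₀| - A ≤ ‖y - X u‖) :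
    |⟪a, fderiv ℝ (fun y : EuclideanSpace ℝ (Fin 3) => ∫ u : ℝ,
        ((‖y - X u‖ ^ 2 + e ^ 2) ^ (3 / 2 : ℝ))⁻¹ • cross (deriv X u) (y - X u)) y a⟫_ℝ| ≤
      8 * Real.pi * (D + A) / (c * D ^ 3) := by
  have hop := biotSavart_fderiv_norm_le (u₀ := u₀) he hc₀ hX hdX hgrow hc hD hA hfar hesc
  set L := fderiv ℝ (fun y : EuclideanSpace ℝ (Fin 3) => ∫ u : ℝ,
        ((‖y - X u‖ ^ 2 + e ^ 2) ^ (3 / 2 : ℝ))⁻¹ • cross (deriv X u) (y - X u)) y with hL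
  calc |⟪a, L a⟫_ℝ| ≤ ‖a‖ * ‖L a‖ := abs_real_inner_le_norm a (L a)
    _ ≤ ‖a‖ * (‖L‖ * ‖a‖) := mul_le_mul_of_nonneg_left (L.le_opNorm a) (norm_nonneg _)
    _ = ‖L‖ := by rw [ha, one_mul, mul_one]
    _ ≤ 8 * Real.pi * (D + A) / (c * D ^ 3) := hop

end SelectionBoxRJRung

end Summit.NavierStokesRegularity.NavierStokesRegularity.Theorems
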